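import Literature.Probability.LatticeModels.TorusSymbolSampling
import Literature.Analysis.Calculus.IteratedDifferenceDerivBound
import Literature.Analysis.Calculus.LineRestrictionIteratedDeriv
import Mathlib.Analysis.Complex.Basic
import HarnessLib

/-!
# Differences of a sampled space-time symbol on `(ℤ/Pℤ)¹ × (ℤ/Lℤ)²`: the `ℓ¹` bounds direction by direction

Topic `Literature/Probability/LatticeModels`; continues `TorusSymbolSampling.lean`.  The symbol of a finite-temperature,
finite-volume lattice fermion propagator is a SAMPLE `G(i, k⃗) = Φ(a₀ + h₀ i, hₓ k̃)` of a continuum symbol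
`Φ : ℝ × ℝ² → E` at the kept Matsubara frequencies (`a₀ + h₀ i = π(2(i - M) + 1)/β`, `h₀ = 2π/β`, plain section `val`
of the time index) and at the torus momenta (`hₓ k̃ = 2πk̃/L`, centred section `valMinAbs`).  The decay machinery
(`TorusFourierAnisotropicDecay.norm_sum_prodChar_smul_mul_one_add_pow_le`) consumes the `ℓ¹` norms
`Σ_p ‖Δ^N G(p)‖` of the iterated differences of `G` along product steps `(v, 0)` (time) and `(0, u)` (space); here
they are bounded by `(N+1) · #{G ≠ 0} · K`, with `K` a bound of the `N`-th derivative of `Φ` along the corresponding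
REAL line (step vector `(h₀, 0)` resp. `(0, hₓu)`), provided `Φ` vanishes near the seams (frequency window well inside
the `P` kept frequencies; momenta well inside the zone):

* `fwdDiff_iter_prod_fst`, `fwdDiff_iter_prod_snd` — differences along `(v,0)` / `(0,u)` act on the partial functions;
* `card_filter_prod_eq_sum_snd/fst` — `#{G ≠ 0} = Σ_{k⃗} #{i : G(i,k⃗) ≠ 0} = Σ_i #{k⃗ : G(i,k⃗) ≠ 0}`;
* **`sum_norm_fwdDiff_iter_time_le`** — `Σ_p ‖(Δ_{(1,0)}^N G)(p)‖ ≤ (N+1) #{G ≠ 0} K₀` if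
  `‖∂ₛ^N Φ(q + s(h₀,0))‖ ≤ K₀` and `Φ(a₀ + h₀ m, ·) = 0` for `m < N` or `m ≥ P - N`;
* **`sum_norm_fwdDiff_iter_space_le`** — `Σ_p ‖(Δ_{(0,ū)}^N G)(p)‖ ≤ (N+1) #{G ≠ 0} K_u` for an integer step `u` if
  `‖∂ₛ^N Φ(q + s(0,hₓu))‖ ≤ K_u` and `Φ(·, hₓ m) = 0` whenever `2|m_j| + 2N|u_j| ≥ L` for some `j`.

Everything is proved; no definitions, no named facts. [folklore]

## Sources

G. Benfatto, A. Giuliani, V. Mastropietro, Ann. Henri Poincaré 7 (2006) 809–898, Lemma 2.2, (2.36aa) and footnote ¹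
(`BenfattoGiulianiMastropietro2006`).  Routine ("folklore").
-/

noncomputable section

open Finset Literature.Analysis.Calculus

namespace Literature.Probability.LatticeModels

/-! ### Differences along product steps -/

section ProdDiff

variable {A B E : Type*} [AddCommMonoid A] [AddCommMonoid B] [AddCommGroup E]

/-- Differences along `(v, 0)` act on the first partial function. [folklore] -/
theorem fwdDiff_iter_prod_fst (G : A × B → E) (v : A) (N : ℕ) (p : A × B) :
    ((fwdDiff (v, (0 : B)))^[N] G) p = ((fwdDiff v)^[N] fun a => G (a, p.2)) p.1 := by
  rw [fwdDiff_iter_eq_sum_shift, fwdDiff_iter_eq_sum_shift]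
  refine sum_congr rfl fun k _ => ?_
  congr 1
  rw [Prod.smul_mk, smul_zero, Prod.add_def, add_zero]

/-- Differences along `(0, u)` act on the second partial function. [folklore] -/
theorem fwdDiff_iter_prod_snd (G : A × B → E) (u : B) (N : ℕ) (p : A × B) :
    ((fwdDiff ((0 : A), u))^[N] G) p = ((fwdDiff u)^[N] fun b => G (p.1, b)) p.2 := by
  rw [fwdDiff_iter_eq_sum_shift, fwdDiff_iter_eq_sum_shift]
  refine sum_congr rfl fun k _ => ?_
  congr 1
  rw [Prod.smul_mk, smul_zero, Prod.add_def, add_zero]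

end ProdDiff

/-! ### Support counts on a product -/

section Count

variable {α β : Type*} [Fintype α] [Fintype β]

/-- `#{(a,b) : Q(a,b)} = Σ_b #{a : Q(a,b)}`. [folklore] -/
theorem card_filter_prod_eq_sum_snd (Q : α × β → Prop) [DecidablePred Q] :
    ((univ.filter Q).card : ℕ) = ∑ b : β, (univ.filter fun a : α => Q (a, b)).card := by
  classical
  simp only [card_filter]
  rw [Fintype.sum_prod_type_right]

/-- `#{(a,b) : Q(a,b)} = Σ_a #{b : Q(a,b)}`. [folklore] -/
theorem card_filter_prod_eq_sum_fst (Q : α × β → Prop) [DecidablePred Q] :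
    ((univ.filter Q).card : ℕ) = ∑ a : α, (univ.filter fun b : β => Q (a, b)).card := by
  classical
  simp only [card_filter]
  rw [Fintype.sum_prod_type]

end Count

/-! ### The sampled symbol -/

section Sampled

variable {P L : ℕ} [NeZero P] [NeZero L] {E : Type*} [NormedAddCommGroup E] [NormedSpace ℝ E]

/-- The time sampling map `m ↦ (h₀ m, 0)` as an additive map `ℤ¹ → ℝ × ℝ²`. [folklore] -/
theorem exists_timeSamplingHom (h₀ : ℝ) :
    ∃ φ : (Fin 1 → ℤ) →+ ℝ × (Fin 2 → ℝ), ∀ m, φ m = (h₀ * (m 0 : ℝ), 0) := by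
  refine ⟨AddMonoidHom.mk' (fun m => (h₀ * (m 0 : ℝ), 0)) fun a b => ?_, fun _ => rfl⟩
  simp only [Pi.add_apply, Int.cast_add, Prod.mk_add_mk, add_zero]
  ring_nf

/-- The space sampling map `m ↦ (0, hₓ m)` as an additive map `ℤ² → ℝ × ℝ²`. [folklore] -/
theorem exists_spaceSamplingHom (hx : ℝ) :
    ∃ φ : (Fin 2 → ℤ) →+ ℝ × (Fin 2 → ℝ), ∀ m, φ m = (0, fun j => hx * (m j : ℝ)) := by
  refine ⟨AddMonoidHom.mk' (fun m => ((0 : ℝ), fun j => hx * (m j : ℝ))) fun a b => ?_, fun _ => rfl⟩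
  simp only [Prod.mk_add_mk, add_zero]
  congr 1
  funext j
  simp only [Pi.add_apply, Int.cast_add]
  ring

/-- **Time differences of a sampled symbol**: let `G(p) = Φ(a₀ + h₀ val(p₁), hₓ p̃₂)` on `(ℤ/Pℤ)¹ × (ℤ/Lℤ)²`; if
`Φ(a₀ + h₀ m, ·)` vanishes for the integers `m < N` and `m ≥ P - N` (the frequency window sits well inside the kept
frequencies) and the `N`-th derivative of `Φ` along the lines `s ↦ q + s(h₀, 0)` is bounded by `K₀` (`Φ` of class
`Cᴺ`), then `Σ_p ‖(Δ_{(1,0)}^N G)(p)‖ ≤ (N+1) · #{G ≠ 0} · K₀`. [cite: BenfattoGiulianiMastropietro2006, (2.36aa)] -/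
theorem sum_norm_fwdDiff_iter_time_le (Φ : ℝ × (Fin 2 → ℝ) → E) (a₀ h₀ hx : ℝ) (N : ℕ) (hΦ : ContDiff ℝ N Φ)
    (G : TorusSite 1 P × TorusSite 2 L → E)
    (hG : ∀ p, G p = Φ (a₀ + h₀ * (((p.1 0).val : ℕ) : ℝ), fun j => hx * (((p.2 j).valMinAbs : ℤ) : ℝ)))
    (hsupp : ∀ (m : ℤ) (k : Fin 2 → ℝ), (m < N ∨ (P : ℤ) ≤ m + N) → Φ (a₀ + h₀ * (m : ℝ), k) = 0)
    {K₀ : ℝ} (hK : ∀ (q : ℝ × (Fin 2 → ℝ)) (s : ℝ), s ∈ Set.Icc (0 : ℝ) N →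
      ‖iteratedDeriv N (fun s : ℝ => Φ (q + s • ((h₀, 0) : ℝ × (Fin 2 → ℝ)))) s‖ ≤ K₀)
    [DecidablePred fun p : TorusSite 1 P × TorusSite 2 L => G p ≠ 0] :
    ∑ p : TorusSite 1 P × TorusSite 2 L, ‖((fwdDiff ((fun _ : Fin 1 => (1 : ZMod P)), (0 : TorusSite 2 L)))^[N] G) p‖ ≤
      ((N : ℝ) + 1) * ((univ.filter fun p : TorusSite 1 P × TorusSite 2 L => G p ≠ 0).card : ℝ) * K₀ := by
  classical
  obtain ⟨φ, hφ⟩ := exists_timeSamplingHom (h₀ := h₀)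
  -- the partial functions at fixed spatial momentum, as sampled functions on `ℤ¹`
  let f : TorusSite 2 L → (Fin 1 → ℤ) → E := fun k m =>
    Φ (((a₀, fun j => hx * (((k j).valMinAbs : ℤ) : ℝ)) : ℝ × (Fin 2 → ℝ)) + φ m)
  have hf : ∀ k m, f k m = Φ (((a₀, fun j => hx * (((k j).valMinAbs : ℤ) : ℝ)) : ℝ × (Fin 2 → ℝ)) + φ m) :=
    fun _ _ => rfl
  have hfG : ∀ (k : TorusSite 2 L) (b : TorusSite 1 P), f k (fun j => ((b j).val : ℤ)) = G (b, k) := by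
    intro k b
    rw [hf, hφ, hG]
    simp
  have hfun : ∀ k : TorusSite 2 L, (fun b : TorusSite 1 P => G (b, k)) = fun b => f k (fun j => ((b j).val : ℤ)) :=
    fun k => funext fun b => (hfG k b).symm
  -- consistency of the plain section from the support hypothesis
  have hcons : ∀ (k : TorusSite 2 L) (a : TorusSite 1 P) (t : ℕ), t ≤ N →
      f k (fun j => ((a j).val : ℤ) + t * (fun _ : Fin 1 => (1 : ℤ)) j) =
        f k (fun j => (((a j + (t : ZMod P) * ((fun _ : Fin 1 => (1 : ℤ)) j : ZMod P)).val : ℕ) : ℤ)) := by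
    intro k a t ht
    refine section_consistent_val (P := P) (f k) (fun _ : Fin 1 => (1 : ℤ)) N (fun m hm => ?_) a t ht
    obtain ⟨j, hj⟩ := hm
    have hj0 : m 0 < N ∨ (P : ℤ) ≤ m 0 + N := by
      have hj' : j = 0 := Subsingleton.elim _ _
      subst hj'
      simpa using hj
    rw [hf, hφ]
    simp only [Prod.mk_add_mk, add_zero]
    exact hsupp (m 0) _ hj0
  -- the bound on the differences of `f k` along `1`, through the line in direction `(h₀, 0)`
  have hKf : ∀ (k : TorusSite 2 L) (a : TorusSite 1 P),
      ‖((fwdDiff (fun _ : Fin 1 => (1 : ℤ)))^[N] (f k)) (fun j => ((a j).val : ℤ))‖ ≤ K₀ := by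
    intro k a
    have hcomp : ((fwdDiff (fun _ : Fin 1 => (1 : ℤ)))^[N] (f k)) (fun j => ((a j).val : ℤ)) =
        ((fwdDiff (φ fun _ : Fin 1 => (1 : ℤ)))^[N] Φ)
          (((a₀, fun j => hx * (((k j).valMinAbs : ℤ) : ℝ)) : ℝ × (Fin 2 → ℝ)) + φ fun j => ((a j).val : ℤ)) :=
      fwdDiff_iter_comp_addMonoidHom φ _ Φ _ N _
    rw [hcomp]
    have hstep : φ (fun _ : Fin 1 => (1 : ℤ)) = ((h₀, 0) : ℝ × (Fin 2 → ℝ)) := by rw [hφ]; simp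
    rw [hstep]
    exact norm_fwdDiff_iter_apply_le_of_line _ _ N Φ (contDiff_lineRestriction hΦ _ _) fun s hs => hK _ s hs
  -- sum over the spatial momentum of the one-dimensional bounds
  have hstep1 : ((fun _ : Fin 1 => (1 : ZMod P)) : TorusSite 1 P) = fun j => (((fun _ : Fin 1 => (1 : ℤ)) j : ℤ) : ZMod P) := by
    funext j; simp
  have h1 : ∀ k : TorusSite 2 L, ∑ b : TorusSite 1 P,
      ‖((fwdDiff (fun j => (((fun _ : Fin 1 => (1 : ℤ)) j : ℤ) : ZMod P)))^[N]
        (fun b : TorusSite 1 P => f k (fun j => ((b j).val : ℤ)))) b‖ ≤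
      ((N : ℝ) + 1) * ((univ.filter fun b : TorusSite 1 P => f k (fun j => ((b j).val : ℤ)) ≠ 0).card : ℝ) * K₀ :=
    fun k => sum_norm_fwdDiff_iter_comp_section_le (fun a : ZMod P => (a.val : ℤ)) (f k) (fun _ : Fin 1 => (1 : ℤ)) N
      (hcons k) (hKf k)
  have hcard : ∀ k : TorusSite 2 L, (univ.filter fun b : TorusSite 1 P => f k (fun j => ((b j).val : ℤ)) ≠ 0) =
      univ.filter fun b : TorusSite 1 P => G (b, k) ≠ 0 := fun k => filter_congr fun b _ => by rw [hfG]
  calc ∑ p : TorusSite 1 P × TorusSite 2 L, ‖((fwdDiff ((fun _ : Fin 1 => (1 : ZMod P)), (0 : TorusSite 2 L)))^[N] G) p‖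
      = ∑ k : TorusSite 2 L, ∑ b : TorusSite 1 P,
          ‖((fwdDiff (fun j => (((fun _ : Fin 1 => (1 : ℤ)) j : ℤ) : ZMod P)))^[N]
            (fun b : TorusSite 1 P => f k (fun j => ((b j).val : ℤ)))) b‖ := by
        rw [Fintype.sum_prod_type_right]
        refine sum_congr rfl fun k _ => sum_congr rfl fun b _ => ?_
        rw [fwdDiff_iter_prod_fst, ← hstep1, hfun k]
    _ ≤ ∑ k : TorusSite 2 L, ((N : ℝ) + 1) * ((univ.filter fun b : TorusSite 1 P => f k (fun j => ((b j).val : ℤ)) ≠ 0).card : ℝ) * K₀ :=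
        sum_le_sum fun k _ => h1 k
    _ = ((N : ℝ) + 1) * ((univ.filter fun p : TorusSite 1 P × TorusSite 2 L => G p ≠ 0).card : ℝ) * K₀ := by
        rw [← sum_mul, ← mul_sum, card_filter_prod_eq_sum_snd (fun p : TorusSite 1 P × TorusSite 2 L => G p ≠ 0)]
        congr 2
        push_cast
        exact sum_congr rfl fun k _ => by rw [hcard k]

/-- **Space differences of a sampled symbol**: with `G` as above and an integer step `u`, if `Φ(·, hₓ m)` vanishes
whenever `2|m_j| + 2N|u_j| ≥ L` for some `j` (the symbol sits well inside the zone) and the `N`-th derivative of `Φ`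
along the lines `s ↦ q + s(0, hₓu)` is bounded by `K` (`Φ` of class `Cᴺ`), then
`Σ_p ‖(Δ_{(0,ū)}^N G)(p)‖ ≤ (N+1) · #{G ≠ 0} · K`. [cite: BenfattoGiulianiMastropietro2006, (2.36aa)] -/
theorem sum_norm_fwdDiff_iter_space_le (Φ : ℝ × (Fin 2 → ℝ) → E) (a₀ h₀ hx : ℝ) (N : ℕ) (hΦ : ContDiff ℝ N Φ)
    (G : TorusSite 1 P × TorusSite 2 L → E)
    (hG : ∀ p, G p = Φ (a₀ + h₀ * (((p.1 0).val : ℕ) : ℝ), fun j => hx * (((p.2 j).valMinAbs : ℤ) : ℝ)))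
    (u : Fin 2 → ℤ)
    (hsupp : ∀ (k₀ : ℝ) (m : Fin 2 → ℤ), (∃ j, (L : ℤ) ≤ 2 * |m j| + 2 * N * |u j|) → Φ (k₀, fun j => hx * (m j : ℝ)) = 0)
    {K : ℝ} (hK : ∀ (q : ℝ × (Fin 2 → ℝ)) (s : ℝ), s ∈ Set.Icc (0 : ℝ) N →
      ‖iteratedDeriv N (fun s : ℝ => Φ (q + s • (((0 : ℝ), fun j => hx * (u j : ℝ)) : ℝ × (Fin 2 → ℝ)))) s‖ ≤ K)
    [DecidablePred fun p : TorusSite 1 P × TorusSite 2 L => G p ≠ 0] :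
    ∑ p : TorusSite 1 P × TorusSite 2 L, ‖((fwdDiff ((0 : TorusSite 1 P), (fun j => ((u j : ℤ) : ZMod L))))^[N] G) p‖ ≤
      ((N : ℝ) + 1) * ((univ.filter fun p : TorusSite 1 P × TorusSite 2 L => G p ≠ 0).card : ℝ) * K := by
  classical
  obtain ⟨φ, hφ⟩ := exists_spaceSamplingHom (hx := hx)
  -- the partial functions at fixed frequency, as sampled functions on `ℤ²`
  let f : TorusSite 1 P → (Fin 2 → ℤ) → E := fun b m =>
    Φ (((a₀ + h₀ * (((b 0).val : ℕ) : ℝ), 0) : ℝ × (Fin 2 → ℝ)) + φ m)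
  have hf : ∀ b m, f b m = Φ (((a₀ + h₀ * (((b 0).val : ℕ) : ℝ), 0) : ℝ × (Fin 2 → ℝ)) + φ m) := fun _ _ => rfl
  have hfG : ∀ (b : TorusSite 1 P) (k : TorusSite 2 L), f b (fun j => (k j).valMinAbs) = G (b, k) := by
    intro b k
    rw [hf, hφ, hG]
    simp
  have hfun : ∀ b : TorusSite 1 P, (fun k : TorusSite 2 L => G (b, k)) = fun k => f b (fun j => (k j).valMinAbs) :=
    fun b => funext fun k => (hfG b k).symm
  have hcons : ∀ (b : TorusSite 1 P) (a : TorusSite 2 L) (t : ℕ), t ≤ N →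
      f b (fun j => (a j).valMinAbs + t * u j) = f b (fun j => (a j + (t : ZMod L) * (u j : ZMod L)).valMinAbs) := by
    intro b a t ht
    refine section_consistent_valMinAbs (P := L) (f b) u N (fun m hm => ?_) a t ht
    rw [hf, hφ]
    simp only [Prod.mk_add_mk, add_zero, zero_add]
    exact hsupp _ m hm
  have hKf : ∀ (b : TorusSite 1 P) (a : TorusSite 2 L), ‖((fwdDiff u)^[N] (f b)) (fun j => (a j).valMinAbs)‖ ≤ K := by
    intro b a
    have hcomp : ((fwdDiff u)^[N] (f b)) (fun j => (a j).valMinAbs) =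
        ((fwdDiff (φ u))^[N] Φ) ((((a₀ + h₀ * (((b 0).val : ℕ) : ℝ), 0)) : ℝ × (Fin 2 → ℝ)) + φ fun j => (a j).valMinAbs) :=
      fwdDiff_iter_comp_addMonoidHom φ _ Φ _ N _
    rw [hcomp, hφ u]
    exact norm_fwdDiff_iter_apply_le_of_line _ _ N Φ (contDiff_lineRestriction hΦ _ _) fun s hs => hK _ s hs
  have h1 : ∀ b : TorusSite 1 P, ∑ k : TorusSite 2 L,
      ‖((fwdDiff (fun j => ((u j : ℤ) : ZMod L)))^[N] (fun k : TorusSite 2 L => f b (fun j => (k j).valMinAbs))) k‖ ≤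
      ((N : ℝ) + 1) * ((univ.filter fun k : TorusSite 2 L => f b (fun j => (k j).valMinAbs) ≠ 0).card : ℝ) * K :=
    fun b => sum_norm_fwdDiff_iter_comp_section_le (fun a : ZMod L => a.valMinAbs) (f b) u N (hcons b) (hKf b)
  have hcard : ∀ b : TorusSite 1 P, (univ.filter fun k : TorusSite 2 L => f b (fun j => (k j).valMinAbs) ≠ 0) =
      univ.filter fun k : TorusSite 2 L => G (b, k) ≠ 0 := fun b => filter_congr fun k _ => by rw [hfG]
  calc ∑ p : TorusSite 1 P × TorusSite 2 L, ‖((fwdDiff ((0 : TorusSite 1 P), (fun j => ((u j : ℤ) : ZMod L))))^[N] G) p‖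
      = ∑ b : TorusSite 1 P, ∑ k : TorusSite 2 L,
          ‖((fwdDiff (fun j => ((u j : ℤ) : ZMod L)))^[N] (fun k : TorusSite 2 L => f b (fun j => (k j).valMinAbs))) k‖ := by
        rw [Fintype.sum_prod_type]
        refine sum_congr rfl fun b _ => sum_congr rfl fun k _ => ?_
        rw [fwdDiff_iter_prod_snd, hfun b]
    _ ≤ ∑ b : TorusSite 1 P, ((N : ℝ) + 1) * ((univ.filter fun k : TorusSite 2 L => f b (fun j => (k j).valMinAbs) ≠ 0).card : ℝ) * K :=
        sum_le_sum fun b _ => h1 b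
    _ = ((N : ℝ) + 1) * ((univ.filter fun p : TorusSite 1 P × TorusSite 2 L => G p ≠ 0).card : ℝ) * K := by
        rw [← sum_mul, ← mul_sum, card_filter_prod_eq_sum_fst (fun p : TorusSite 1 P × TorusSite 2 L => G p ≠ 0)]
        congr 2
        push_cast
        exact sum_congr rfl fun b _ => by rw [hcard b]

end Sampled

end Literature.Probability.LatticeModels
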